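import Mathlib
import Literature.Analysis.UnboundedOperators.ConjugateOperatorRegularity
import HarnessLib
import Summits.AtomisticToContinuum.FouriersLaw.Theorems.EmbeddedDrudeMourreMourreDissolutionLAPResolventIdentity
import Summits.AtomisticToContinuum.FouriersLaw.Theorems.EmbeddedDrudeMourreMourreDissolutionLAPRegularityAlgebraMul

/-!
# Stub `stub_mourreThresholdLAP` — Mourre LAP infrastructure 9: regularity of `R(z)` at every non-real `z`

Item `stmt-AtomisticToContinuum-12594` (crux `MourreDissolution` of route `EmbeddedDrudeMourre`,
sub-problem `FouriersLaw`), line `separable-vertex-faddeev-pair-sector`, stub S6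
`stub_mourreThresholdLAP` (Mourre's limiting absorption principle; NOT in the tree). First step of
L3 of the proof map (ABG Lemma 6.2.1 for the classes `C¹` and `𝒞^{1,1}`), combining L1
(`…LAPResolventIdentity`) with L2 (`…LAPRegularityAlgebraMul`): the stub's hypotheses
`HamiltonianOfClassC1/C11 U A` concern `R(-i) = resolventNegI U` only; here they are transported
to `R(z) = resolventAt U z` for every non-real `z`.

* §1 the transition operators `V = 1 + (z - z₀) R(z)` and `W = 1 - (z - z₀) R(z₀)`: `V W = W V = 1`
  and `R(z) = R(z₀) V = V R(z₀)` (first resolvent identity);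
* §2 `R(z₀) ∈ C¹(A; H) ⇒ R(z) ∈ C¹(A; H)` with `[R(z), iA] = V [R(z₀), iA] V` (for `H ∈ C¹(A)` this
  is ABG (6.2.7)/(6.2.13): `[R(z), iA] = -R(z)[H, iA]R(z)`), and
  `R(z₀) ∈ C¹ ∩ 𝒞^{1,1} ⇒ R(z) ∈ C¹ ∩ 𝒞^{1,1}`; specialised to `z₀ = -i`:
  `HamiltonianOfClassC1 U A → IsOfClassC1 A (resolventAt U z)` and the `𝒞^{1,1}` analogue
  (headline `resolventAt_regular_of_hamiltonianOfClass`).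
-/

noncomputable section

open MeasureTheory Complex Filter Topology Set
open scoped InnerProductSpace ComplexConjugate ENNReal NNReal

namespace Summit.AtomisticToContinuum.FouriersLaw.Theorems.MourreDissolution

open Literature.Analysis.UnboundedOperators
open Literature.Analysis.UnboundedOperators.UnitaryRep

variable {H : Type*} [NormedAddCommGroup H] [InnerProductSpace ℂ H] [CompleteSpace H]

/-! ## §1. The transition operators between two points of the resolvent set -/

/-- `(z - z₀)² R(z) R(z₀) = (z - z₀)(R(z) - R(z₀))` (the first resolvent identity, rescaled).
[folklore] -/
theorem smul_sq_resolventAt_mul {z z₀ : ℂ} (hz : z.im ≠ 0) (hz₀ : z₀.im ≠ 0)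
    (U : OneParameterUnitaryGroup H) :
    ((z - z₀) * (z - z₀)) • (resolventAt U z * resolventAt U z₀) =
      (z - z₀) • resolventAt U z - (z - z₀) • resolventAt U z₀ := by
  rw [← smul_smul, ← resolventAt_sub hz hz₀ U, smul_sub]

/-- **`V W = 1`** for `V = 1 + (z - z₀) R(z)`, `W = 1 - (z - z₀) R(z₀)`. [folklore] -/
theorem transition_mul_transition' {z z₀ : ℂ} (hz : z.im ≠ 0) (hz₀ : z₀.im ≠ 0)
    (U : OneParameterUnitaryGroup H) :
    (1 + (z - z₀) • resolventAt U z) * (1 - (z - z₀) • resolventAt U z₀) = 1 := by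
  have key := smul_sq_resolventAt_mul hz hz₀ U
  calc (1 + (z - z₀) • resolventAt U z) * (1 - (z - z₀) • resolventAt U z₀)
      = 1 - (z - z₀) • resolventAt U z₀ + (z - z₀) • resolventAt U z -
          ((z - z₀) * (z - z₀)) • (resolventAt U z * resolventAt U z₀) := by
        simp only [mul_sub, add_mul, one_mul, mul_one, smul_mul_assoc, mul_smul_comm, smul_add,
          smul_smul]
        abel
    _ = 1 := by rw [key]; abel

/-- **`W V = 1`** for `V = 1 + (z - z₀) R(z)`, `W = 1 - (z - z₀) R(z₀)` (resolvents commute).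
[folklore] -/
theorem transition'_mul_transition {z z₀ : ℂ} (hz : z.im ≠ 0) (hz₀ : z₀.im ≠ 0)
    (U : OneParameterUnitaryGroup H) :
    (1 - (z - z₀) • resolventAt U z₀) * (1 + (z - z₀) • resolventAt U z) = 1 := by
  have key := smul_sq_resolventAt_mul hz hz₀ U
  rw [resolventAt_comm hz hz₀ U] at key
  calc (1 - (z - z₀) • resolventAt U z₀) * (1 + (z - z₀) • resolventAt U z)
      = 1 - (z - z₀) • resolventAt U z₀ + (z - z₀) • resolventAt U z -
          ((z - z₀) * (z - z₀)) • (resolventAt U z₀ * resolventAt U z) := by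
        simp only [mul_add, sub_mul, one_mul, mul_one, smul_mul_assoc, mul_smul_comm, smul_sub,
          smul_smul]
        abel
    _ = 1 := by rw [key]; abel

/-- **`R(z) = R(z₀) V`**, `V = 1 + (z - z₀) R(z)`. [folklore] -/
theorem resolventAt_eq_mul_transition {z z₀ : ℂ} (hz : z.im ≠ 0) (hz₀ : z₀.im ≠ 0)
    (U : OneParameterUnitaryGroup H) :
    resolventAt U z = resolventAt U z₀ * (1 + (z - z₀) • resolventAt U z) := by
  rw [mul_add, mul_one, mul_smul_comm, ← resolventAt_comm hz hz₀ U, ← resolventAt_sub hz hz₀ U]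
  abel

/-- **`R(z) = V R(z₀)`**, `V = 1 + (z - z₀) R(z)`. [folklore] -/
theorem resolventAt_eq_transition_mul {z z₀ : ℂ} (hz : z.im ≠ 0) (hz₀ : z₀.im ≠ 0)
    (U : OneParameterUnitaryGroup H) :
    resolventAt U z = (1 + (z - z₀) • resolventAt U z) * resolventAt U z₀ := by
  rw [add_mul, one_mul, smul_mul_assoc, ← resolventAt_sub hz hz₀ U]
  abel

/-! ## §2. Regularity of `R(z)` from regularity of `R(z₀)` -/

/-- `W = 1 - (z - z₀) R(z₀)` has the commutator `-(z - z₀) [R(z₀), iA]`. [folklore] -/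
theorem hasCommutator_transition' {A : OneParameterUnitaryGroup H} {U : OneParameterUnitaryGroup H}
    {z₀ : ℂ} {D : H →L[ℂ] H} (h : A.HasCommutator (resolventAt U z₀) D) (z : ℂ) :
    A.HasCommutator (1 - (z - z₀) • resolventAt U z₀) (-((z - z₀) • D)) := by
  have := (A.hasCommutator_one).add (h.smul (-(z - z₀)))
  simp only [neg_smul, zero_add] at this
  simpa [sub_eq_add_neg] using this

/-- **Regularity transport (ABG Lemma 6.2.1 for `C¹`) with the commutator formula**: if
`x ↦ 𝒲(x)[R(z₀)]` has strong derivative `D` at `0`, then for every non-real `z`,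
`x ↦ 𝒲(x)[R(z)]` has strong derivative `V D V`, `V = 1 + (z - z₀) R(z)` (`R(z) = R(z₀) V`,
`V = W⁻¹`, Leibniz and inverse rules; for `H ∈ C¹(A)` this is `[R(z), iA] = -R(z)[H, iA]R(z)`,
ABG (6.2.7)). [cite: AmreinBoutetdeMonvelGeorgescu1996, Lemma 6.2.1] -/
theorem hasCommutator_resolventAt_of_hasCommutator {A : OneParameterUnitaryGroup H}
    {U : OneParameterUnitaryGroup H} {z z₀ : ℂ} (hz : z.im ≠ 0) (hz₀ : z₀.im ≠ 0) {D : H →L[ℂ] H}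
    (h : A.HasCommutator (resolventAt U z₀) D) :
    A.HasCommutator (resolventAt U z)
      ((1 + (z - z₀) • resolventAt U z) * D * (1 + (z - z₀) • resolventAt U z)) := by
  set V := 1 + (z - z₀) • resolventAt U z with hV
  have hW := hasCommutator_transition' h z
  have hVc := hasCommutator_inverse hW (transition'_mul_transition hz hz₀ U)
    (transition_mul_transition' hz hz₀ U)
  have hprod := h.mul hVc
  rw [← hV] at hprod
  rw [← resolventAt_eq_mul_transition hz hz₀ U] at hprod
  have e2 : D * V + resolventAt U z₀ * -(V * -((z - z₀) • D) * V) = V * D * V := by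
    have e1 : resolventAt U z₀ * V = resolventAt U z := (resolventAt_eq_mul_transition hz hz₀ U).symm
    calc D * V + resolventAt U z₀ * -(V * -((z - z₀) • D) * V)
        = D * V + (z - z₀) • ((resolventAt U z₀ * V) * D * V) := by
          simp only [mul_neg, neg_mul, neg_neg, mul_smul_comm, smul_mul_assoc, mul_assoc]
      _ = D * V + (z - z₀) • (resolventAt U z * D * V) := by rw [e1]
      _ = V * D * V := by
          conv_rhs => rw [hV]
          rw [add_mul, add_mul, one_mul, smul_mul_assoc, smul_mul_assoc]
  rw [e2] at hprod
  exact hprod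

/-- **`R(z₀) ∈ C¹(A; H) ⇒ R(z) ∈ C¹(A; H)`** for all non-real `z`.
[cite: AmreinBoutetdeMonvelGeorgescu1996, Lemma 6.2.1] -/
theorem isOfClassC1_resolventAt_of_isOfClassC1 {A U : OneParameterUnitaryGroup H} {z z₀ : ℂ}
    (hz : z.im ≠ 0) (hz₀ : z₀.im ≠ 0) (h : A.IsOfClassC1 (resolventAt U z₀)) :
    A.IsOfClassC1 (resolventAt U z) :=
  (hasCommutator_resolventAt_of_hasCommutator hz hz₀ h.hasCommutator).isOfClassC1

/-- **`R(z₀) ∈ C¹ ∩ 𝒞^{1,1} ⇒ R(z) ∈ C¹ ∩ 𝒞^{1,1}`** for all non-real `z` (the transition operator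
`W = 1 - (z - z₀)R(z₀)` is in both classes, hence so is `V = W⁻¹` and `R(z) = R(z₀) V`).
[cite: AmreinBoutetdeMonvelGeorgescu1996, Lemma 6.2.1] -/
theorem isOfClassC11_resolventAt_of_isOfClassC11 {A U : OneParameterUnitaryGroup H} {z z₀ : ℂ}
    (hz : z.im ≠ 0) (hz₀ : z₀.im ≠ 0) (h1 : A.IsOfClassC1 (resolventAt U z₀))
    (h11 : A.IsOfClassC11 (resolventAt U z₀)) : A.IsOfClassC11 (resolventAt U z) := by
  have hW1 : A.IsOfClassC1 (1 - (z - z₀) • resolventAt U z₀) :=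
    (hasCommutator_transition' h1.hasCommutator z).isOfClassC1
  have hW11 : A.IsOfClassC11 (1 - (z - z₀) • resolventAt U z₀) :=
    isOfClassC11_sub (A.isOfClassC11_one) (isOfClassC11_smul h11 _)
  obtain ⟨hV1, hV11⟩ := isOfClassC1_and_C11_inverse hW1 hW11 (transition'_mul_transition hz hz₀ U)
    (transition_mul_transition' hz hz₀ U)
  rw [resolventAt_eq_mul_transition hz hz₀ U]
  exact isOfClassC11_mul h1 hV1 h11 hV11

/-- **`H ∈ C¹(A) ⇒ R(z) ∈ C¹(A; H)` for every non-real `z`** (the hypothesis `HamiltonianOfClassC1`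
is the case `z = -i`). [cite: AmreinBoutetdeMonvelGeorgescu1996, Lemma 6.2.1] -/
theorem isOfClassC1_resolventAt {A U : OneParameterUnitaryGroup H} (h : U.HamiltonianOfClassC1 A)
    {z : ℂ} (hz : z.im ≠ 0) : A.IsOfClassC1 (resolventAt U z) :=
  isOfClassC1_resolventAt_of_isOfClassC1 hz (z₀ := -I) (by simp)
    ((hamiltonianOfClassC1_iff U A).1 h)

/-- **The commutator of `R(z)` in terms of that of `R(-i)`**:
`[R(z), iA] = V [R(-i), iA] V`, `V = 1 + (z + i) R(z)`. [cite: AmreinBoutetdeMonvelGeorgescu1996, Lemma 6.2.1] -/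
theorem commutatorCLM_resolventAt {A U : OneParameterUnitaryGroup H} (h : U.HamiltonianOfClassC1 A)
    {z : ℂ} (hz : z.im ≠ 0) :
    A.commutatorCLM (resolventAt U z) =
      (1 + (z + I) • resolventAt U z) * A.commutatorCLM (resolventAt U (-I)) *
        (1 + (z + I) • resolventAt U z) := by
  have h0 : A.IsOfClassC1 (resolventAt U (-I)) := (hamiltonianOfClassC1_iff U A).1 h
  have := hasCommutator_resolventAt_of_hasCommutator hz (z₀ := -I) (by simp) h0.hasCommutator
  simp only [sub_neg_eq_add] at this
  exact this.commutatorCLM_eq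

/-- **`H ∈ C¹(A) ∩ 𝒞^{1,1}(A) ⇒ R(z) ∈ 𝒞^{1,1}(A; H)` for every non-real `z`.**
[cite: AmreinBoutetdeMonvelGeorgescu1996, Lemma 6.2.1] -/
theorem isOfClassC11_resolventAt {A U : OneParameterUnitaryGroup H} (h1 : U.HamiltonianOfClassC1 A)
    (h11 : U.HamiltonianOfClassC11 A) {z : ℂ} (hz : z.im ≠ 0) :
    A.IsOfClassC11 (resolventAt U z) :=
  isOfClassC11_resolventAt_of_isOfClassC11 hz (z₀ := -I) (by simp)
    ((hamiltonianOfClassC1_iff U A).1 h1) ((hamiltonianOfClassC11_iff U A).1 h11)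

/-- `R(z)` and `R(z)*= R(z̄)` are both regular; products such as `R(z̄) R(z) = |R(z)|²` stay in the
classes. [folklore] -/
theorem isOfClassC1_resolventAt_conj_mul {A U : OneParameterUnitaryGroup H}
    (h : U.HamiltonianOfClassC1 A) {z : ℂ} (hz : z.im ≠ 0) :
    A.IsOfClassC1 (resolventAt U (conj z) * resolventAt U z) := by
  have hz' : (conj z).im ≠ 0 := by rw [Complex.conj_im]; exact neg_ne_zero.2 hz
  exact (isOfClassC1_resolventAt h hz').mul (isOfClassC1_resolventAt h hz)

/-- `‖V‖ ≤ 1 + |z - z₀| / |Im z|` for the transition operator `V = 1 + (z - z₀) R(z)`. [folklore] -/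
theorem norm_transition_le {z : ℂ} (hz : z.im ≠ 0) (z₀ : ℂ) (U : OneParameterUnitaryGroup H) :
    ‖(1 : H →L[ℂ] H) + (z - z₀) • resolventAt U z‖ ≤ 1 + ‖z - z₀‖ * |z.im|⁻¹ := by
  refine (norm_add_le _ _).trans ?_
  rw [norm_smul]
  gcongr
  · exact ContinuousLinearMap.norm_id_le
  · exact norm_resolventAt_le_inv_abs hz U

/-- **Growth of the commutator of `R(z)` towards the real axis**:
`‖[R(z), iA]‖ ≤ (1 + |z + i|/|Im z|)² ‖[R(-i), iA]‖` (polynomial blow-up `≲ ⟨z⟩²|Im z|⁻²`, the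
input of the resolvent-based functional calculi of ABG §6.2). [cite: AmreinBoutetdeMonvelGeorgescu1996, Lemma 6.2.1] -/
theorem norm_commutatorCLM_resolventAt_le {A U : OneParameterUnitaryGroup H}
    (h : U.HamiltonianOfClassC1 A) {z : ℂ} (hz : z.im ≠ 0) :
    ‖A.commutatorCLM (resolventAt U z)‖ ≤
      (1 + ‖z + I‖ * |z.im|⁻¹) ^ 2 * ‖A.commutatorCLM (resolventAt U (-I))‖ := by
  rw [commutatorCLM_resolventAt h hz]
  have hV := norm_transition_le hz (-I) U
  simp only [sub_neg_eq_add] at hV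
  have h0 : 0 ≤ 1 + ‖z + I‖ * |z.im|⁻¹ := by positivity
  calc ‖(1 + (z + I) • resolventAt U z) * A.commutatorCLM (resolventAt U (-I)) *
        (1 + (z + I) • resolventAt U z)‖
      ≤ ‖(1 : H →L[ℂ] H) + (z + I) • resolventAt U z‖ * ‖A.commutatorCLM (resolventAt U (-I))‖ *
          ‖(1 : H →L[ℂ] H) + (z + I) • resolventAt U z‖ := norm_mul₃_le
    _ ≤ (1 + ‖z + I‖ * |z.im|⁻¹) * ‖A.commutatorCLM (resolventAt U (-I))‖ *
          (1 + ‖z + I‖ * |z.im|⁻¹) := by gcongr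
    _ = (1 + ‖z + I‖ * |z.im|⁻¹) ^ 2 * ‖A.commutatorCLM (resolventAt U (-I))‖ := by ring

/-- **Lipschitz bound for `R(z)` along the conjugate group**:
`‖𝒲(x)[R(z)] - R(z)‖ ≤ |x| (1 + |z + i|/|Im z|)² ‖[R(-i), iA]‖`. [folklore] -/
theorem norm_conjAut_resolventAt_sub_le {A U : OneParameterUnitaryGroup H}
    (h : U.HamiltonianOfClassC1 A) {z : ℂ} (hz : z.im ≠ 0) (x : ℝ) :
    ‖A.conjAut x (resolventAt U z) - resolventAt U z‖ ≤
      |x| * ((1 + ‖z + I‖ * |z.im|⁻¹) ^ 2 * ‖A.commutatorCLM (resolventAt U (-I))‖) :=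
  (norm_conjAut_sub_le (isOfClassC1_resolventAt h hz).hasCommutator x).trans
    (by gcongr; exact norm_commutatorCLM_resolventAt_le h hz)

/-! ## §3. Headline (registered helper stub) -/

/-- **Regularity of the resolvent at every non-real point, headline form** (all binders explicit;
registered helper stub of `stub_mourreThresholdLAP`; ABG Lemma 6.2.1 for the classes `C¹` and
`𝒞^{1,1}`): under the stub's hypotheses `HamiltonianOfClassC1 U A`, `HamiltonianOfClassC11 U A`,
the resolvent through the group `resolventAt U z` is of class `C¹(A; H)` and `𝒞^{1,1}(A; H)` for
every non-real `z`. [cite: AmreinBoutetdeMonvelGeorgescu1996, Lemma 6.2.1] -/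
theorem resolventAt_regular_of_hamiltonianOfClass :
    ∀ (K : Type) [NormedAddCommGroup K] [InnerProductSpace ℂ K] [CompleteSpace K]
      (U A : Literature.Analysis.UnboundedOperators.OneParameterUnitaryGroup K) (z : ℂ),
      U.HamiltonianOfClassC1 A → U.HamiltonianOfClassC11 A → z.im ≠ 0 →
        A.IsOfClassC1
            (Summit.AtomisticToContinuum.FouriersLaw.Theorems.MourreDissolution.resolventAt U z) ∧
          A.IsOfClassC11
            (Summit.AtomisticToContinuum.FouriersLaw.Theorems.MourreDissolution.resolventAt U z) := by
  intro K _ _ _ U A z h1 h11 hz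
  exact ⟨isOfClassC1_resolventAt h1 hz, isOfClassC11_resolventAt h1 h11 hz⟩

end Summit.AtomisticToContinuum.FouriersLaw.Theorems.MourreDissolution
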